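import Summits.ResolutionOfSingularities.ResolutionOfSingularities.Theorems.FrobeniusLadderFRationalResolutionIntegralForm
import Summits.ResolutionOfSingularities.ResolutionOfSingularities.Theorems.FrobeniusLadderFRationalResolutionStubRungsOfSummit
import Literature.AlgebraicGeometry.Resolution.QuasiProjectiveResolution
import HarnessLib

/-!
# Crux `FRationalResolution` is EQUIVALENT to the two inserted rungs of line `Sketch`

Route `FrobeniusLadder`, rank-4 crux `FRationalResolution` (stmt-ResolutionOfSingularities-15317). The
line `Sketch` (idea card `test-ideal-rung-to-f-regular`) inserts a rung between "F-rational" and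
"regular": RUNG 3½ (`WeaklyFRegularModification`: every integral F-rational `X/k` has a proper
birational model whose stalks are domains with EVERY ideal tightly closed) and RUNG 4′
(`WeaklyFRegularResolution`: such weakly F-regular locally-integral `X/k` have resolutions), composed
onto the crux in `Cruxes/FRationalResolution/Lines/Sketch.lean`.

`fRationalResolution_iff_rungs` proves that this split LOSES NOTHING: the crux is equivalent to the
conjunction of the two rungs (stated verbatim as the registered stubs `stub_weaklyFRegularModification`,
`stub_weaklyFRegularResolution` of the skeleton, with the instance binders as hypotheses).

* crux ⇒ rung 3½: a resolution `X̃ → X` of an integral F-rational `X` (the crux in its integral form,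
  `fRationalResolution_iff_integral`) IS a weakly F-regular model — a regular local ring is a domain in
  which every ideal is tightly closed (`isTightlyClosed_of_isRegularLocalRing`, Kunz; characteristic of
  the stalks by `RungsOfSummit.charP_stalk_of_over`);
* crux ⇒ rung 4′: a weakly F-regular stalk is F-rational (specialise "every ideal" to the s.o.p.
  ideals), and `X` is its own model along `𝟙 X`;
* rungs ⇒ crux: integral F-rational `X` ↦ weakly F-regular model `X' → X` (3½) ↦ resolution of `X'`
  (4′) ↦ resolution of `X` (`Scheme.HasResolution.of_isBirational`), then
  `fRationalResolution_iff_integral`.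

So promoting the two stubs to route items is a glued split `3½ → 4′ → FRationalResolution` whose glue
is an equivalence.
-/

-- single-problem summit: the doubled namespace component `ResolutionOfSingularities` is forced
set_option linter.dupNamespace false

noncomputable section

open CategoryTheory AlgebraicGeometry TopologicalSpace
open Literature.AlgebraicGeometry.Resolution Literature.RingTheory.TightClosure

namespace Summit.ResolutionOfSingularities.ResolutionOfSingularities.Theorems.FRationalResolution

/-- A scheme all of whose stalks are domains is reduced. [folklore] -/
theorem isReduced_of_isDomain_stalk (X : Scheme.{0}) (hdom : ∀ x : X, IsDomain (X.presheaf.stalk x)) :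
    IsReduced X := by
  haveI : ∀ x : X, _root_.IsReduced (X.presheaf.stalk x) := fun x => by
    haveI := hdom x
    infer_instance
  exact isReduced_of_isReduced_stalk X

/-- The stalks of a regular scheme over a field of prime characteristic `p` are domains in which every
ideal is tightly closed (inline form): a resolution is a weakly F-regular model.
(`isDomain_of_isRegularLocalRing`, `isTightlyClosed_of_isRegularLocalRing` via Kunz, unfolded by
`isTightlyClosed_iff_of_isDomain`.) -/
theorem weaklyFRegular_stalk_of_isRegular {p : ℕ} (hp : p.Prime) (k : Type) [Field k] [CharP k p]
    {Y : Scheme.{0}} (g : Y ⟶ Spec (.of k)) (hY : Scheme.IsRegular Y) (y : Y) :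
    IsDomain (Y.presheaf.stalk y) ∧ ∀ I : Ideal (Y.presheaf.stalk y),
      ∀ a c : Y.presheaf.stalk y, c ≠ 0 →
      (∀ e : ℕ, c * a ^ p ^ e ∈ Ideal.span ((fun z : Y.presheaf.stalk y => z ^ p ^ e) ''
        (I : Set (Y.presheaf.stalk y)))) → a ∈ I := by
  haveI : Fact p.Prime := ⟨hp⟩
  haveI : IsRegularLocalRing (Y.presheaf.stalk y) := hY y
  haveI : IsDomain (Y.presheaf.stalk y) := isDomain_of_isRegularLocalRing _
  haveI : CharP (Y.presheaf.stalk y) p := RungsOfSummit.charP_stalk_of_over hp.ne_zero k g y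
  exact ⟨inferInstance, fun I =>
    (isTightlyClosed_iff_of_isDomain p).mp (isTightlyClosed_of_isRegularLocalRing p I)⟩

/-- **Crux `FRationalResolution` ↔ RUNG 3½ ∧ RUNG 4′.** The rank-4 crux of route `FrobeniusLadder`
(resolution of varieties admitting an F-rational proper birational model) is EQUIVALENT to the
conjunction of the two rungs inserted by line `Sketch` (card `test-ideal-rung-to-f-regular`):
(3½) every integral separated finite-type `X/k` with F-rational stalks has a proper birational model
all of whose stalks are domains with every ideal tightly closed (weakly F-regular), and (4′) every
separated finite-type `X/k` with such weakly F-regular stalks has a resolution. (⇒: a resolution is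
a weakly F-regular model, and weakly F-regular stalks are F-rational; ⇐: compose the rungs and
transport along the model, `fRationalResolution_iff_integral`.) -/
theorem fRationalResolution_iff_rungs :
    Summit.ResolutionOfSingularities.ResolutionOfSingularities.Theses.FrobeniusLadder.FRationalResolution ↔
      ((∀ (p : ℕ), p.Prime → ∀ (k : Type) [Field k] [CharP k p] (X : Scheme.{0})
        (f : X ⟶ Spec (.of k)), IsSeparated f → LocallyOfFiniteType f → QuasiCompact f →
        IsIntegral X →
        (∀ x : X, IsDomain (X.presheaf.stalk x) ∧ ∀ d : ℕ, ringKrullDim (X.presheaf.stalk x) = d →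
          ∀ s : Fin d → X.presheaf.stalk x, (Ideal.span (Set.range s)).radical.IsMaximal →
          ∀ y c : X.presheaf.stalk x, c ≠ 0 →
          (∀ e : ℕ, c * y ^ p ^ e ∈ Ideal.span ((fun z : X.presheaf.stalk x => z ^ p ^ e) ''
            (Ideal.span (Set.range s) : Set (X.presheaf.stalk x)))) →
            y ∈ Ideal.span (Set.range s)) →
        ∃ (X' : Scheme.{0}) (π : X' ⟶ X), IsProper π ∧ IsBirational π ∧
          ∀ x : X', IsDomain (X'.presheaf.stalk x) ∧ ∀ I : Ideal (X'.presheaf.stalk x),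
            ∀ y c : X'.presheaf.stalk x, c ≠ 0 →
            (∀ e : ℕ, c * y ^ p ^ e ∈ Ideal.span ((fun z : X'.presheaf.stalk x => z ^ p ^ e) ''
              (I : Set (X'.presheaf.stalk x)))) → y ∈ I) ∧
      (∀ (p : ℕ), p.Prime → ∀ (k : Type) [Field k] [CharP k p] (X : Scheme.{0})
        (f : X ⟶ Spec (.of k)), IsSeparated f → LocallyOfFiniteType f → QuasiCompact f →
        (∀ x : X, IsDomain (X.presheaf.stalk x) ∧ ∀ I : Ideal (X.presheaf.stalk x),
          ∀ y c : X.presheaf.stalk x, c ≠ 0 →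
          (∀ e : ℕ, c * y ^ p ^ e ∈ Ideal.span ((fun z : X.presheaf.stalk x => z ^ p ^ e) ''
            (I : Set (X.presheaf.stalk x)))) → y ∈ I) →
        Scheme.HasResolution X)) := by
  constructor
  · intro hcrux
    have hint := fRationalResolution_iff_integral.mp hcrux
    refine ⟨fun p hp k _ _ X f hsep hft hqc hX hFR => ?_, fun p hp k _ _ X f hsep hft hqc hW => ?_⟩
    · -- rung 3½: a resolution of the integral F-rational `X` is a weakly F-regular model
      obtain ⟨X', π, hres⟩ := hint p hp k X f hsep hft hqc hX hFR
      haveI := hres.isProper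
      exact ⟨X', π, hres.isProper, hres.isBirational,
        weaklyFRegular_stalk_of_isRegular hp k (π ≫ f) hres.isRegular⟩
    · -- rung 4′: weakly F-regular stalks are F-rational; `X` is its own model along `𝟙 X`
      haveI : IsReduced X := isReduced_of_isDomain_stalk X fun x => (hW x).1
      unfold Summit.ResolutionOfSingularities.ResolutionOfSingularities.Theses.FrobeniusLadder.FRationalResolution
        at hcrux
      refine hcrux p hp k X f hsep hft hqc inferInstance ⟨X, 𝟙 X, inferInstance, ⟨⊤, ?_, ?_, ?_⟩,
        fun x => ⟨(hW x).1, fun d _ s _ y c hc hy => (hW x).2 (Ideal.span (Set.range s)) y c hc hy⟩⟩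
      · simp
      · simp
      · infer_instance
  · rintro ⟨h₁, h₂⟩
    refine fRationalResolution_iff_integral.mpr fun p hp k _ _ X f hsep hft hqc hX hFR => ?_
    obtain ⟨X', π, hπ, hbir, hW⟩ := h₁ p hp k X f hsep hft hqc hX hFR
    haveI := hπ
    haveI := hsep
    haveI := hft
    haveI := hqc
    exact Scheme.HasResolution.of_isBirational π hbir
      (h₂ p hp k X' (π ≫ f) inferInstance inferInstance inferInstance hW)

end Summit.ResolutionOfSingularities.ResolutionOfSingularities.Theorems.FRationalResolution

end
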